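/-
Copyright (c) 2026 the pub-hodgecm-mathlib formalisation cell (harness21).  Prover seat hodgecm-mathlib-F0P3a-p03 (g18): road «S3-ram» (LEAD F0P3a-plan (g13); owner∕table
F0P3a-p06 (g15)), the type-(2) G-side (Cnt2′) assembly of chair F0P3a-p07 (g14): organ «(z4-a′) CLASS-FUNCTION LEMMA» (chair RULING (5), 2026-09-02T02:25:51Z), FILE 1∕2
(datum-free half); 2026-09-02.
-/
import Literature.NumberTheory.Automorphic.UnitaryLatticeTreeFormTransport   -- ★ p847249 (F0P3a-p01 (g16)): `ncard_selfDual_fixed_{sep,bd,deep,reg,rankOne}_eq_of_formCongr`, `exists_mem_mapGL_class_iff`, the level-token transports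
import HarnessLib

/-!
# The five strata counts of fixed self-dual lattices are CLASS FUNCTIONS on the unitary group: for `u ∈ U(σ, H)` the counts at `uγu⁻¹` and at `γ` agree
# (Bruhat–Tits 1972 §10; Kottwitz 1986 §3; Rogawski 1990 §4.9)

Topic `NumberTheory/Automorphic`; namespace `Literature.NumberTheory.Automorphic.UnitaryLatticeTree`.  THEOREMS ONLY (no definition, no instance, no notation, no named fact,
no `sorry`); kernel lane `--supports stmt-HodgeConjecture-24833`; datum-free (`K` any field with `Valued K ℤᵐ⁰`, `σ` any ring endomorphism, any rank `N`).  Cell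
`pub/hodgecm-mathlib` (D-0151), crux H413; road «S3-ram» (Literature seeding, count-neutral); organ «(z4-a′) CLASS-FUNCTION LEMMA» of the (Cnt2′) chair's ROADMAP v1.1
§1′ bullet 3 (`F0/P3a/F0P3a-p07/g14/cnt2/ROADMAP-Cnt2-zero-pm.v1_1.F0P3ap07g14.md`): the rows `0`, `1±` of the type-(2) signed-count assembly are stated for ARBITRARY matches
`tp`, `tm` of the two `κ`-signs, while the organs compute the counts at two chosen LITERALS `t₀`, `t₁`; since matches of the same sign are conjugate (★
`finKappaAt_eq_iff_isConj`), what is needed is that each lattice count is a class function.  FILE 2∕2 (`Rogawski1990/DepthZeroKappaTransferTypeTwoRamifiedClassFunction`)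
reads this file in the CM one-place currency of ★ p847724 and adds the `κ`-feed.

THE MATHEMATICS (elementary).  ★ `UnitaryLatticeTreeFormTransport` §5 proves, for ANY `P ∈ GL_N(K)`, that `M ↦ P·M` carries `{M self-dual for ᵗσ(P)HP, γM = M, LABEL(γ, M)}`
bijectively onto `{M self-dual for H, (PγP⁻¹)M = M, LABEL(PγP⁻¹, M)}` for each of the five labels of the (a2) token sheet (`bd`: `¬ (γ−1)M ⊆ ϖM`; `0`: `(γ−1)M ⊆ ϖ²M`;
`reg`: `(γ−1)M ⊆ ϖM ∧ ¬ ⊆ ϖ²M ∧ ¬ (γ−1)²M ⊆ ϖ³M`; `1□_c` ∕ `¬1□_c`: `… ∧ (γ−1)²M ⊆ ϖ³M ∧ [¬] CLS_c`).  When `P = u` is UNITARY for `H`, `ᵗσ(u) H u = H` (the defining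
equation, ★ `mem_unitaryGroupOfForm_iff`), so both sides live in the SAME model and the statement becomes: the count at `uγu⁻¹` equals the count at `γ` (§2), also
spelled for elements `u t` of the subgroup `U(σ, H)` with `γ = t` (§3, the shape met through a frame isomorphism `e : G′_v ≃* U(σ_w, Φ₃)`: `e (x t x⁻¹) = e x · e t · (e x)⁻¹`).
HONEST LABEL: HC_CM is proved only modulo the 2 remaining named inputs (hLiu418 24832, h413 24833) until rung 0 closes; nothing printed is asserted here (change of basis
by an isometry), no books consequence.

* §1 `formCongr_eq_of_mem_unitaryGroupOfForm` — `u ∈ U(σ,H) → ᵗσ(u) H u = H`.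
* §2 `ncard_selfDual_fixed_{sep,bd,deep,reg,rankOne,rankOneNot}_conj_eq_of_mem_unitaryGroupOfForm` — counts at `uγu⁻¹` = counts at `γ` (`u ∈ U(σ,H)`, `γ ∈ GL_N(K)`);
  `ncard_selfDual_fixed_rankOneNot_eq_of_formCongr` — the «¬1□_c» line of ★ p847249 §5 for a general change of basis `P` (completing that list).
* §3 `ncard_selfDual_fixed_{bd,deep,reg,rankOne,rankOneNot}_coe_conj_eq` — the same for `u t : ↥U(σ,H)`, element `↑(u * t * u⁻¹)`.

## References
* [BruhatTits1972] F. Bruhat, J. Tits, *Groupes réductifs sur un corps local I*, Publ. Math. IHÉS 41 (1972), §10 (the building of `U(H)`; `U(H)`-equivariance).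
* [Kottwitz1986] R. E. Kottwitz, *Base change for unit elements of Hecke algebras*, Compositio Math. 60 (1986), §3 (fixed-lattice counts are orbital integrals, hence class functions).
* [Rogawski1990] J. D. Rogawski, *Automorphic Representations of Unitary Groups in Three Variables*, Ann. of Math. Stud. 123 (1990), §4.9 pp. 54–55 (Lemma 4.9.3: the count
  depends only on the conjugacy class).
* [Serre1980Trees] J.-P. Serre, *Trees* (1980), Ch. II §1.1.
-/

set_option autoImplicit false

noncomputable section

open scoped Valued WithZero Matrix MatrixGroups

namespace Literature.NumberTheory.Automorphic.UnitaryLatticeTree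

open Literature.NumberTheory.Automorphic Literature.NumberTheory.Automorphic.HermitianLattice

variable {K : Type*} [Field K] [Valued K ℤᵐ⁰] {N : ℕ}

/-! ## §1 A unitary change of basis does not change the form -/

omit [Valued K ℤᵐ⁰] in
/-- **`ᵗσ(u) H u = H` for `u ∈ U(σ, H)`** — the defining equation of the unitary group, read as «`formCongr σ u H = H`». [cite: Rogawski1990, §4.9 p. 54] -/
theorem formCongr_eq_of_mem_unitaryGroupOfForm (σ : K →+* K) (H : Matrix (Fin N) (Fin N) K) {u : GL (Fin N) K} (hu : u ∈ unitaryGroupOfForm σ H) :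
    formCongr σ u H = H :=
  mem_unitaryGroupOfForm_iff.1 hu

/-! ## §2 The strata counts at `uγu⁻¹` and at `γ` agree for `u` unitary -/

/-- **COUNT AT A UNITARY CONJUGATE (general label)**: if `Q₁ (u·M) ↔ Q₂ M` for all `M`, then for `u ∈ U(σ,H)`
`#{M self-dual for H, (uγu⁻¹)M = M, Q₁ M} = #{M self-dual for H, γM = M, Q₂ M}` (★ `ncard_selfDual_fixed_sep_eq_of_formCongr` with `ᵗσ(u) H u = H`).
[cite: Kottwitz1986, §3] [cite: Rogawski1990, §4.9 Lemma 4.9.3 p. 55] -/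
theorem ncard_selfDual_fixed_sep_conj_eq_of_mem_unitaryGroupOfForm (σ : K →+* K) (ϖ : K) (H : Matrix (Fin N) (Fin N) K) {u : GL (Fin N) K}
    (hu : u ∈ unitaryGroupOfForm σ H) (γ : GL (Fin N) K) (Q₁ Q₂ : Submodule 𝒪[K] (Fin N → K) → Prop) (hQ : ∀ M, Q₁ (mapGL u M) ↔ Q₂ M) :
    {M : Submodule 𝒪[K] (Fin N → K) | IsSelfDualLattice σ ϖ H M ∧ mapGL (u * γ * u⁻¹) M = M ∧ Q₁ M}.ncard =
      {M : Submodule 𝒪[K] (Fin N → K) | IsSelfDualLattice σ ϖ H M ∧ mapGL γ M = M ∧ Q₂ M}.ncard := by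
  have h := ncard_selfDual_fixed_sep_eq_of_formCongr σ ϖ H u γ Q₁ Q₂ hQ
  rwa [formCongr_eq_of_mem_unitaryGroupOfForm σ H hu] at h

/-- **COUNT AT A UNITARY CONJUGATE, stratum «bd»** (`¬ (γ−1)M ⊆ ϖM`). [cite: Rogawski1990, §4.9 p. 55] [cite: Kottwitz1986, §3] -/
theorem ncard_selfDual_fixed_bd_conj_eq_of_mem_unitaryGroupOfForm (σ : K →+* K) (ϖ : K) (H : Matrix (Fin N) (Fin N) K) {u : GL (Fin N) K}
    (hu : u ∈ unitaryGroupOfForm σ H) (γ : GL (Fin N) K) :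
    {M : Submodule 𝒪[K] (Fin N → K) | IsSelfDualLattice σ ϖ H M ∧ mapGL (u * γ * u⁻¹) M = M ∧
        ¬ M.map ((Matrix.toLin' (((u * γ * u⁻¹ : GL (Fin N) K) : Matrix (Fin N) (Fin N) K) - 1)).restrictScalars 𝒪[K]) ≤ scaleLattice ϖ M}.ncard =
      {M : Submodule 𝒪[K] (Fin N → K) | IsSelfDualLattice σ ϖ H M ∧ mapGL γ M = M ∧
        ¬ M.map ((Matrix.toLin' ((γ : Matrix (Fin N) (Fin N) K) - 1)).restrictScalars 𝒪[K]) ≤ scaleLattice ϖ M}.ncard := by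
  have h := ncard_selfDual_fixed_bd_eq_of_formCongr σ ϖ H u γ
  rwa [formCongr_eq_of_mem_unitaryGroupOfForm σ H hu] at h

/-- **COUNT AT A UNITARY CONJUGATE, stratum «0»** (`(γ−1)M ⊆ ϖ²M`). [cite: Rogawski1990, §4.9 p. 55] [cite: Kottwitz1986, §3] -/
theorem ncard_selfDual_fixed_deep_conj_eq_of_mem_unitaryGroupOfForm (σ : K →+* K) (ϖ : K) (H : Matrix (Fin N) (Fin N) K) {u : GL (Fin N) K}
    (hu : u ∈ unitaryGroupOfForm σ H) (γ : GL (Fin N) K) :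
    {M : Submodule 𝒪[K] (Fin N → K) | IsSelfDualLattice σ ϖ H M ∧ mapGL (u * γ * u⁻¹) M = M ∧
        M.map ((Matrix.toLin' (((u * γ * u⁻¹ : GL (Fin N) K) : Matrix (Fin N) (Fin N) K) - 1)).restrictScalars 𝒪[K]) ≤ scaleLattice (ϖ ^ 2) M}.ncard =
      {M : Submodule 𝒪[K] (Fin N → K) | IsSelfDualLattice σ ϖ H M ∧ mapGL γ M = M ∧
        M.map ((Matrix.toLin' ((γ : Matrix (Fin N) (Fin N) K) - 1)).restrictScalars 𝒪[K]) ≤ scaleLattice (ϖ ^ 2) M}.ncard := by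
  have h := ncard_selfDual_fixed_deep_eq_of_formCongr σ ϖ H u γ
  rwa [formCongr_eq_of_mem_unitaryGroupOfForm σ H hu] at h

/-- **COUNT AT A UNITARY CONJUGATE, stratum «reg»** (`(γ−1)M ⊆ ϖM`, `¬ ⊆ ϖ²M`, `¬ (γ−1)²M ⊆ ϖ³M`). [cite: Rogawski1990, §4.9 p. 55] [cite: Kottwitz1986, §3] -/
theorem ncard_selfDual_fixed_reg_conj_eq_of_mem_unitaryGroupOfForm (σ : K →+* K) (ϖ : K) (H : Matrix (Fin N) (Fin N) K) {u : GL (Fin N) K}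
    (hu : u ∈ unitaryGroupOfForm σ H) (γ : GL (Fin N) K) :
    {M : Submodule 𝒪[K] (Fin N → K) | IsSelfDualLattice σ ϖ H M ∧ mapGL (u * γ * u⁻¹) M = M ∧
        (M.map ((Matrix.toLin' (((u * γ * u⁻¹ : GL (Fin N) K) : Matrix (Fin N) (Fin N) K) - 1)).restrictScalars 𝒪[K]) ≤ scaleLattice ϖ M ∧
          ¬ M.map ((Matrix.toLin' (((u * γ * u⁻¹ : GL (Fin N) K) : Matrix (Fin N) (Fin N) K) - 1)).restrictScalars 𝒪[K]) ≤ scaleLattice (ϖ ^ 2) M ∧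
            ¬ M.map ((Matrix.toLin' ((((u * γ * u⁻¹ : GL (Fin N) K) : Matrix (Fin N) (Fin N) K) - 1) ^ 2)).restrictScalars 𝒪[K]) ≤ scaleLattice (ϖ ^ 3) M)}.ncard =
      {M : Submodule 𝒪[K] (Fin N → K) | IsSelfDualLattice σ ϖ H M ∧ mapGL γ M = M ∧
        (M.map ((Matrix.toLin' ((γ : Matrix (Fin N) (Fin N) K) - 1)).restrictScalars 𝒪[K]) ≤ scaleLattice ϖ M ∧
          ¬ M.map ((Matrix.toLin' ((γ : Matrix (Fin N) (Fin N) K) - 1)).restrictScalars 𝒪[K]) ≤ scaleLattice (ϖ ^ 2) M ∧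
            ¬ M.map ((Matrix.toLin' (((γ : Matrix (Fin N) (Fin N) K) - 1) ^ 2)).restrictScalars 𝒪[K]) ≤ scaleLattice (ϖ ^ 3) M)}.ncard := by
  have h := ncard_selfDual_fixed_reg_eq_of_formCongr σ ϖ H u γ
  rwa [formCongr_eq_of_mem_unitaryGroupOfForm σ H hu] at h

/-- **COUNT AT A UNITARY CONJUGATE, the rank-one class stratum «1□_c»** (`(γ−1)M ⊆ ϖM`, `¬ ⊆ ϖ²M`, `(γ−1)²M ⊆ ϖ³M`, class token with constants `ϖ′`, `c`); the
pairing is taken for the SAME form `H` on both sides because `u` is an isometry. [cite: Rogawski1990, §4.9 p. 55] [cite: Kottwitz1986, §3] -/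
theorem ncard_selfDual_fixed_rankOne_conj_eq_of_mem_unitaryGroupOfForm (σ : K →+* K) (ϖ : K) (H : Matrix (Fin N) (Fin N) K) {u : GL (Fin N) K}
    (hu : u ∈ unitaryGroupOfForm σ H) (γ : GL (Fin N) K) (ϖ' c : K) :
    {M : Submodule 𝒪[K] (Fin N → K) | IsSelfDualLattice σ ϖ H M ∧ mapGL (u * γ * u⁻¹) M = M ∧
        (M.map ((Matrix.toLin' (((u * γ * u⁻¹ : GL (Fin N) K) : Matrix (Fin N) (Fin N) K) - 1)).restrictScalars 𝒪[K]) ≤ scaleLattice ϖ M ∧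
          ¬ M.map ((Matrix.toLin' (((u * γ * u⁻¹ : GL (Fin N) K) : Matrix (Fin N) (Fin N) K) - 1)).restrictScalars 𝒪[K]) ≤ scaleLattice (ϖ ^ 2) M ∧
            M.map ((Matrix.toLin' ((((u * γ * u⁻¹ : GL (Fin N) K) : Matrix (Fin N) (Fin N) K) - 1) ^ 2)).restrictScalars 𝒪[K]) ≤ scaleLattice (ϖ ^ 3) M ∧
              ∃ y ∈ M, ∃ a : K, Valued.v a = 1 ∧
                Valued.v (ϖ' * pairing σ H y ((((u * γ * u⁻¹ : GL (Fin N) K) : Matrix (Fin N) (Fin N) K) - 1) *ᵥ y) - c * a ^ 2) < 1)}.ncard =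
      {M : Submodule 𝒪[K] (Fin N → K) | IsSelfDualLattice σ ϖ H M ∧ mapGL γ M = M ∧
        (M.map ((Matrix.toLin' ((γ : Matrix (Fin N) (Fin N) K) - 1)).restrictScalars 𝒪[K]) ≤ scaleLattice ϖ M ∧
          ¬ M.map ((Matrix.toLin' ((γ : Matrix (Fin N) (Fin N) K) - 1)).restrictScalars 𝒪[K]) ≤ scaleLattice (ϖ ^ 2) M ∧
            M.map ((Matrix.toLin' (((γ : Matrix (Fin N) (Fin N) K) - 1) ^ 2)).restrictScalars 𝒪[K]) ≤ scaleLattice (ϖ ^ 3) M ∧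
              ∃ y ∈ M, ∃ a : K, Valued.v a = 1 ∧
                Valued.v (ϖ' * pairing σ H y (((γ : Matrix (Fin N) (Fin N) K) - 1) *ᵥ y) - c * a ^ 2) < 1)}.ncard := by
  have h := ncard_selfDual_fixed_rankOne_eq_of_formCongr σ ϖ H u γ ϖ' c
  rwa [formCongr_eq_of_mem_unitaryGroupOfForm σ H hu] at h

/-- **COUNT TRANSPORT, the complementary rank-one stratum «¬1□_c»** (★ p847249's §5 list completed: same level tokens, NEGATED class token), for ANY change of
basis `P`: `#{M self-dual for H, (PγP⁻¹)M = M, ¬1□_c(PγP⁻¹, M)} = #{M self-dual for ᵗσ(P)HP, γM = M, ¬1□_c(γ, M)}`. [cite: Rogawski1990, §4.9 p. 55] [cite: Kottwitz1986, §3] -/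
theorem ncard_selfDual_fixed_rankOneNot_eq_of_formCongr (σ : K →+* K) (ϖ : K) (H : Matrix (Fin N) (Fin N) K) (P γ : GL (Fin N) K) (ϖ' c : K) :
    {M : Submodule 𝒪[K] (Fin N → K) | IsSelfDualLattice σ ϖ H M ∧ mapGL (P * γ * P⁻¹) M = M ∧
        (M.map ((Matrix.toLin' (((P * γ * P⁻¹ : GL (Fin N) K) : Matrix (Fin N) (Fin N) K) - 1)).restrictScalars 𝒪[K]) ≤ scaleLattice ϖ M ∧
          ¬ M.map ((Matrix.toLin' (((P * γ * P⁻¹ : GL (Fin N) K) : Matrix (Fin N) (Fin N) K) - 1)).restrictScalars 𝒪[K]) ≤ scaleLattice (ϖ ^ 2) M ∧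
            M.map ((Matrix.toLin' ((((P * γ * P⁻¹ : GL (Fin N) K) : Matrix (Fin N) (Fin N) K) - 1) ^ 2)).restrictScalars 𝒪[K]) ≤ scaleLattice (ϖ ^ 3) M ∧
              ¬ ∃ y ∈ M, ∃ a : K, Valued.v a = 1 ∧
                Valued.v (ϖ' * pairing σ H y ((((P * γ * P⁻¹ : GL (Fin N) K) : Matrix (Fin N) (Fin N) K) - 1) *ᵥ y) - c * a ^ 2) < 1)}.ncard =
      {M : Submodule 𝒪[K] (Fin N → K) | IsSelfDualLattice σ ϖ (formCongr σ P H) M ∧ mapGL γ M = M ∧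
        (M.map ((Matrix.toLin' ((γ : Matrix (Fin N) (Fin N) K) - 1)).restrictScalars 𝒪[K]) ≤ scaleLattice ϖ M ∧
          ¬ M.map ((Matrix.toLin' ((γ : Matrix (Fin N) (Fin N) K) - 1)).restrictScalars 𝒪[K]) ≤ scaleLattice (ϖ ^ 2) M ∧
            M.map ((Matrix.toLin' (((γ : Matrix (Fin N) (Fin N) K) - 1) ^ 2)).restrictScalars 𝒪[K]) ≤ scaleLattice (ϖ ^ 3) M ∧
              ¬ ∃ y ∈ M, ∃ a : K, Valued.v a = 1 ∧
                Valued.v (ϖ' * pairing σ (formCongr σ P H) y (((γ : Matrix (Fin N) (Fin N) K) - 1) *ᵥ y) - c * a ^ 2) < 1)}.ncard :=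
  ncard_selfDual_fixed_sep_eq_of_formCongr σ ϖ H P γ _ _ fun M => by
    rw [map_conj_sub_one_le_scaleLattice_iff, map_conj_sub_one_le_scaleLattice_iff, map_conj_sub_one_sq_le_scaleLattice_iff, exists_mem_mapGL_class_iff]

/-- **COUNT AT A UNITARY CONJUGATE, the complementary rank-one stratum «¬1□_c»** (same level tokens, NEGATED class token). [cite: Rogawski1990, §4.9 p. 55] [cite: Kottwitz1986, §3] -/
theorem ncard_selfDual_fixed_rankOneNot_conj_eq_of_mem_unitaryGroupOfForm (σ : K →+* K) (ϖ : K) (H : Matrix (Fin N) (Fin N) K) {u : GL (Fin N) K}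
    (hu : u ∈ unitaryGroupOfForm σ H) (γ : GL (Fin N) K) (ϖ' c : K) :
    {M : Submodule 𝒪[K] (Fin N → K) | IsSelfDualLattice σ ϖ H M ∧ mapGL (u * γ * u⁻¹) M = M ∧
        (M.map ((Matrix.toLin' (((u * γ * u⁻¹ : GL (Fin N) K) : Matrix (Fin N) (Fin N) K) - 1)).restrictScalars 𝒪[K]) ≤ scaleLattice ϖ M ∧
          ¬ M.map ((Matrix.toLin' (((u * γ * u⁻¹ : GL (Fin N) K) : Matrix (Fin N) (Fin N) K) - 1)).restrictScalars 𝒪[K]) ≤ scaleLattice (ϖ ^ 2) M ∧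
            M.map ((Matrix.toLin' ((((u * γ * u⁻¹ : GL (Fin N) K) : Matrix (Fin N) (Fin N) K) - 1) ^ 2)).restrictScalars 𝒪[K]) ≤ scaleLattice (ϖ ^ 3) M ∧
              ¬ ∃ y ∈ M, ∃ a : K, Valued.v a = 1 ∧
                Valued.v (ϖ' * pairing σ H y ((((u * γ * u⁻¹ : GL (Fin N) K) : Matrix (Fin N) (Fin N) K) - 1) *ᵥ y) - c * a ^ 2) < 1)}.ncard =
      {M : Submodule 𝒪[K] (Fin N → K) | IsSelfDualLattice σ ϖ H M ∧ mapGL γ M = M ∧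
        (M.map ((Matrix.toLin' ((γ : Matrix (Fin N) (Fin N) K) - 1)).restrictScalars 𝒪[K]) ≤ scaleLattice ϖ M ∧
          ¬ M.map ((Matrix.toLin' ((γ : Matrix (Fin N) (Fin N) K) - 1)).restrictScalars 𝒪[K]) ≤ scaleLattice (ϖ ^ 2) M ∧
            M.map ((Matrix.toLin' (((γ : Matrix (Fin N) (Fin N) K) - 1) ^ 2)).restrictScalars 𝒪[K]) ≤ scaleLattice (ϖ ^ 3) M ∧
              ¬ ∃ y ∈ M, ∃ a : K, Valued.v a = 1 ∧
                Valued.v (ϖ' * pairing σ H y (((γ : Matrix (Fin N) (Fin N) K) - 1) *ᵥ y) - c * a ^ 2) < 1)}.ncard := by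
  have h := ncard_selfDual_fixed_rankOneNot_eq_of_formCongr σ ϖ H u γ ϖ' c
  rwa [formCongr_eq_of_mem_unitaryGroupOfForm σ H hu] at h

/-! ## §3 The same for elements of the subgroup `U(σ, H)`: the counts at `↑(u t u⁻¹)` and at `↑t` -/

omit [Valued K ℤᵐ⁰] in
/-- `↑(u * t * u⁻¹) = ↑u * ↑t * (↑u)⁻¹` in `GL_N(K)` for `u t : ↥U(σ,H)`. [folklore] -/
private theorem coe_conj_unitaryGroupOfForm (σ : K →+* K) (H : Matrix (Fin N) (Fin N) K) (u t : ↥(unitaryGroupOfForm σ H)) :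
    ((u * t * u⁻¹ : ↥(unitaryGroupOfForm σ H)) : GL (Fin N) K) = (u : GL (Fin N) K) * (t : GL (Fin N) K) * (u : GL (Fin N) K)⁻¹ := by
  rw [Subgroup.coe_mul, Subgroup.coe_mul, Subgroup.coe_inv]

/-- **Stratum «bd» is a class function on `U(σ,H)`.** [cite: Rogawski1990, §4.9 Lemma 4.9.3 p. 55] [cite: Kottwitz1986, §3] -/
theorem ncard_selfDual_fixed_bd_coe_conj_eq (σ : K →+* K) (ϖ : K) (H : Matrix (Fin N) (Fin N) K) (u t : ↥(unitaryGroupOfForm σ H)) :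
    {M : Submodule 𝒪[K] (Fin N → K) | IsSelfDualLattice σ ϖ H M ∧ mapGL ((u * t * u⁻¹ : ↥(unitaryGroupOfForm σ H)) : GL (Fin N) K) M = M ∧
        ¬ M.map ((Matrix.toLin' ((((u * t * u⁻¹ : ↥(unitaryGroupOfForm σ H)) : GL (Fin N) K) : Matrix (Fin N) (Fin N) K) - 1)).restrictScalars 𝒪[K]) ≤ scaleLattice ϖ M}.ncard =
      {M : Submodule 𝒪[K] (Fin N → K) | IsSelfDualLattice σ ϖ H M ∧ mapGL (t : GL (Fin N) K) M = M ∧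
        ¬ M.map ((Matrix.toLin' (((t : GL (Fin N) K) : Matrix (Fin N) (Fin N) K) - 1)).restrictScalars 𝒪[K]) ≤ scaleLattice ϖ M}.ncard := by
  rw [coe_conj_unitaryGroupOfForm]
  exact ncard_selfDual_fixed_bd_conj_eq_of_mem_unitaryGroupOfForm σ ϖ H u.2 _

/-- **Stratum «0» is a class function on `U(σ,H)`.** [cite: Rogawski1990, §4.9 Lemma 4.9.3 p. 55] [cite: Kottwitz1986, §3] -/
theorem ncard_selfDual_fixed_deep_coe_conj_eq (σ : K →+* K) (ϖ : K) (H : Matrix (Fin N) (Fin N) K) (u t : ↥(unitaryGroupOfForm σ H)) :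
    {M : Submodule 𝒪[K] (Fin N → K) | IsSelfDualLattice σ ϖ H M ∧ mapGL ((u * t * u⁻¹ : ↥(unitaryGroupOfForm σ H)) : GL (Fin N) K) M = M ∧
        M.map ((Matrix.toLin' ((((u * t * u⁻¹ : ↥(unitaryGroupOfForm σ H)) : GL (Fin N) K) : Matrix (Fin N) (Fin N) K) - 1)).restrictScalars 𝒪[K]) ≤ scaleLattice (ϖ ^ 2) M}.ncard =
      {M : Submodule 𝒪[K] (Fin N → K) | IsSelfDualLattice σ ϖ H M ∧ mapGL (t : GL (Fin N) K) M = M ∧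
        M.map ((Matrix.toLin' (((t : GL (Fin N) K) : Matrix (Fin N) (Fin N) K) - 1)).restrictScalars 𝒪[K]) ≤ scaleLattice (ϖ ^ 2) M}.ncard := by
  rw [coe_conj_unitaryGroupOfForm]
  exact ncard_selfDual_fixed_deep_conj_eq_of_mem_unitaryGroupOfForm σ ϖ H u.2 _

/-- **Stratum «reg» is a class function on `U(σ,H)`.** [cite: Rogawski1990, §4.9 Lemma 4.9.3 p. 55] [cite: Kottwitz1986, §3] -/
theorem ncard_selfDual_fixed_reg_coe_conj_eq (σ : K →+* K) (ϖ : K) (H : Matrix (Fin N) (Fin N) K) (u t : ↥(unitaryGroupOfForm σ H)) :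
    {M : Submodule 𝒪[K] (Fin N → K) | IsSelfDualLattice σ ϖ H M ∧ mapGL ((u * t * u⁻¹ : ↥(unitaryGroupOfForm σ H)) : GL (Fin N) K) M = M ∧
        (M.map ((Matrix.toLin' ((((u * t * u⁻¹ : ↥(unitaryGroupOfForm σ H)) : GL (Fin N) K) : Matrix (Fin N) (Fin N) K) - 1)).restrictScalars 𝒪[K]) ≤ scaleLattice ϖ M ∧
          ¬ M.map ((Matrix.toLin' ((((u * t * u⁻¹ : ↥(unitaryGroupOfForm σ H)) : GL (Fin N) K) : Matrix (Fin N) (Fin N) K) - 1)).restrictScalars 𝒪[K]) ≤ scaleLattice (ϖ ^ 2) M ∧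
            ¬ M.map ((Matrix.toLin' (((((u * t * u⁻¹ : ↥(unitaryGroupOfForm σ H)) : GL (Fin N) K) : Matrix (Fin N) (Fin N) K) - 1) ^ 2)).restrictScalars 𝒪[K]) ≤ scaleLattice (ϖ ^ 3) M)}.ncard =
      {M : Submodule 𝒪[K] (Fin N → K) | IsSelfDualLattice σ ϖ H M ∧ mapGL (t : GL (Fin N) K) M = M ∧
        (M.map ((Matrix.toLin' (((t : GL (Fin N) K) : Matrix (Fin N) (Fin N) K) - 1)).restrictScalars 𝒪[K]) ≤ scaleLattice ϖ M ∧
          ¬ M.map ((Matrix.toLin' (((t : GL (Fin N) K) : Matrix (Fin N) (Fin N) K) - 1)).restrictScalars 𝒪[K]) ≤ scaleLattice (ϖ ^ 2) M ∧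
            ¬ M.map ((Matrix.toLin' ((((t : GL (Fin N) K) : Matrix (Fin N) (Fin N) K) - 1) ^ 2)).restrictScalars 𝒪[K]) ≤ scaleLattice (ϖ ^ 3) M)}.ncard := by
  rw [coe_conj_unitaryGroupOfForm]
  exact ncard_selfDual_fixed_reg_conj_eq_of_mem_unitaryGroupOfForm σ ϖ H u.2 _

/-- **The rank-one class stratum «1□_c» is a class function on `U(σ,H)`.** [cite: Rogawski1990, §4.9 Lemma 4.9.3 p. 55] [cite: Kottwitz1986, §3] -/
theorem ncard_selfDual_fixed_rankOne_coe_conj_eq (σ : K →+* K) (ϖ : K) (H : Matrix (Fin N) (Fin N) K) (u t : ↥(unitaryGroupOfForm σ H)) (ϖ' c : K) :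
    {M : Submodule 𝒪[K] (Fin N → K) | IsSelfDualLattice σ ϖ H M ∧ mapGL ((u * t * u⁻¹ : ↥(unitaryGroupOfForm σ H)) : GL (Fin N) K) M = M ∧
        (M.map ((Matrix.toLin' ((((u * t * u⁻¹ : ↥(unitaryGroupOfForm σ H)) : GL (Fin N) K) : Matrix (Fin N) (Fin N) K) - 1)).restrictScalars 𝒪[K]) ≤ scaleLattice ϖ M ∧
          ¬ M.map ((Matrix.toLin' ((((u * t * u⁻¹ : ↥(unitaryGroupOfForm σ H)) : GL (Fin N) K) : Matrix (Fin N) (Fin N) K) - 1)).restrictScalars 𝒪[K]) ≤ scaleLattice (ϖ ^ 2) M ∧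
            M.map ((Matrix.toLin' (((((u * t * u⁻¹ : ↥(unitaryGroupOfForm σ H)) : GL (Fin N) K) : Matrix (Fin N) (Fin N) K) - 1) ^ 2)).restrictScalars 𝒪[K]) ≤ scaleLattice (ϖ ^ 3) M ∧
              ∃ y ∈ M, ∃ a : K, Valued.v a = 1 ∧
                Valued.v (ϖ' * pairing σ H y (((((u * t * u⁻¹ : ↥(unitaryGroupOfForm σ H)) : GL (Fin N) K) : Matrix (Fin N) (Fin N) K) - 1) *ᵥ y) - c * a ^ 2) < 1)}.ncard =
      {M : Submodule 𝒪[K] (Fin N → K) | IsSelfDualLattice σ ϖ H M ∧ mapGL (t : GL (Fin N) K) M = M ∧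
        (M.map ((Matrix.toLin' (((t : GL (Fin N) K) : Matrix (Fin N) (Fin N) K) - 1)).restrictScalars 𝒪[K]) ≤ scaleLattice ϖ M ∧
          ¬ M.map ((Matrix.toLin' (((t : GL (Fin N) K) : Matrix (Fin N) (Fin N) K) - 1)).restrictScalars 𝒪[K]) ≤ scaleLattice (ϖ ^ 2) M ∧
            M.map ((Matrix.toLin' ((((t : GL (Fin N) K) : Matrix (Fin N) (Fin N) K) - 1) ^ 2)).restrictScalars 𝒪[K]) ≤ scaleLattice (ϖ ^ 3) M ∧
              ∃ y ∈ M, ∃ a : K, Valued.v a = 1 ∧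
                Valued.v (ϖ' * pairing σ H y ((((t : GL (Fin N) K) : Matrix (Fin N) (Fin N) K) - 1) *ᵥ y) - c * a ^ 2) < 1)}.ncard := by
  rw [coe_conj_unitaryGroupOfForm]
  exact ncard_selfDual_fixed_rankOne_conj_eq_of_mem_unitaryGroupOfForm σ ϖ H u.2 _ ϖ' c

/-- **The complementary rank-one stratum «¬1□_c» is a class function on `U(σ,H)`.** [cite: Rogawski1990, §4.9 Lemma 4.9.3 p. 55] [cite: Kottwitz1986, §3] -/
theorem ncard_selfDual_fixed_rankOneNot_coe_conj_eq (σ : K →+* K) (ϖ : K) (H : Matrix (Fin N) (Fin N) K) (u t : ↥(unitaryGroupOfForm σ H)) (ϖ' c : K) :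
    {M : Submodule 𝒪[K] (Fin N → K) | IsSelfDualLattice σ ϖ H M ∧ mapGL ((u * t * u⁻¹ : ↥(unitaryGroupOfForm σ H)) : GL (Fin N) K) M = M ∧
        (M.map ((Matrix.toLin' ((((u * t * u⁻¹ : ↥(unitaryGroupOfForm σ H)) : GL (Fin N) K) : Matrix (Fin N) (Fin N) K) - 1)).restrictScalars 𝒪[K]) ≤ scaleLattice ϖ M ∧
          ¬ M.map ((Matrix.toLin' ((((u * t * u⁻¹ : ↥(unitaryGroupOfForm σ H)) : GL (Fin N) K) : Matrix (Fin N) (Fin N) K) - 1)).restrictScalars 𝒪[K]) ≤ scaleLattice (ϖ ^ 2) M ∧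
            M.map ((Matrix.toLin' (((((u * t * u⁻¹ : ↥(unitaryGroupOfForm σ H)) : GL (Fin N) K) : Matrix (Fin N) (Fin N) K) - 1) ^ 2)).restrictScalars 𝒪[K]) ≤ scaleLattice (ϖ ^ 3) M ∧
              ¬ ∃ y ∈ M, ∃ a : K, Valued.v a = 1 ∧
                Valued.v (ϖ' * pairing σ H y (((((u * t * u⁻¹ : ↥(unitaryGroupOfForm σ H)) : GL (Fin N) K) : Matrix (Fin N) (Fin N) K) - 1) *ᵥ y) - c * a ^ 2) < 1)}.ncard =
      {M : Submodule 𝒪[K] (Fin N → K) | IsSelfDualLattice σ ϖ H M ∧ mapGL (t : GL (Fin N) K) M = M ∧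
        (M.map ((Matrix.toLin' (((t : GL (Fin N) K) : Matrix (Fin N) (Fin N) K) - 1)).restrictScalars 𝒪[K]) ≤ scaleLattice ϖ M ∧
          ¬ M.map ((Matrix.toLin' (((t : GL (Fin N) K) : Matrix (Fin N) (Fin N) K) - 1)).restrictScalars 𝒪[K]) ≤ scaleLattice (ϖ ^ 2) M ∧
            M.map ((Matrix.toLin' ((((t : GL (Fin N) K) : Matrix (Fin N) (Fin N) K) - 1) ^ 2)).restrictScalars 𝒪[K]) ≤ scaleLattice (ϖ ^ 3) M ∧
              ¬ ∃ y ∈ M, ∃ a : K, Valued.v a = 1 ∧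
                Valued.v (ϖ' * pairing σ H y ((((t : GL (Fin N) K) : Matrix (Fin N) (Fin N) K) - 1) *ᵥ y) - c * a ^ 2) < 1)}.ncard := by
  rw [coe_conj_unitaryGroupOfForm]
  exact ncard_selfDual_fixed_rankOneNot_conj_eq_of_mem_unitaryGroupOfForm σ ϖ H u.2 _ ϖ' c

end Literature.NumberTheory.Automorphic.UnitaryLatticeTree

end
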